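import Summits.QuantumAdvantage.QuantumAdvantage.Theorems.MobiusLadderDigitPolyUniformityStubSingleDigitLemmas
import Literature.NumberTheory.LFunctions.MoebiusWalshFourierProofs
import HarnessLib

/-!
# `DigitPolyUniformity` (stmt-QuantumAdvantage-1392) — line `Sketch`, stub `stub_singleDigit`

Prime dilates of a single binary digit decorrelate: there is an absolute `C` (here `C = 32`) with

  `|Σ_{1 ≤ m ≤ M} (−1)^{bit_j(pm)} (−1)^{bit_j(qm)}| ≤ C M/(pq) + C M q²(j+1)/2^j + C 2^j`

for all odd primes `p < q`, digit positions `j` and lengths `M`.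

Proof. With `P = 2^{j+1}` the digit sign `(−1)^{bit_j x}` is the square wave
`g(x) = [P/2 ≤ x mod P ? −1 : 1]` (`GreenWalsh.sgn_testBit_eq`), so `m ↦ g(pm)g(qm)` is `P`-periodic
and `|Σ_{1≤m≤M}| ≤ (M/P)|Σ_{m<P} g(pm)g(qm)| + P` (`abs_sum_range_le_of_periodic`). Expanding `g` in
its finite Fourier series on `ℤ/P` (`GreenWalsh.fourier_inversion`; coefficients
`|ĝ(h)| ≤ 2/min(h, P−h)` by `GreenWalsh.norm_squareWave_coeff_le`, and `ĝ(0) = 0` by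
`sum_squareWave_eq_zero`) and using orthogonality (`GreenWalsh.sum_range_fourierChar_div`),
`Σ_{m<P} g(pm)g(qm) = P Σ_{P ∣ ph + qh'} ĝ(h)ĝ(h')` (`sum_mul_dilates_eq`). The partner sum is
bounded in the companion file (`StubSingleDigit.double_sum_le` = the registered sub-goal
`singleDigit_partner_sum_le`:
`≤ 16/(pq) + 16(p+q)(1 + log P)/P ≤ 16/(pq) + 32 q(j+1)/2^j`), whence
`|Σ_{1≤m≤M}| ≤ 16M/(pq) + 32 M q(j+1)/2^j + 2^{j+1}`.
Pure finite Fourier analysis; everything used is proved in the tree / Mathlib.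
-/

noncomputable section

namespace Summit.QuantumAdvantage.DigitPolyUniformity.Sketch

open scoped FourierTransform
open Filter Finset

namespace StubSingleDigit

open Literature.NumberTheory.LFunctions.GreenWalsh (fourier_inversion sum_range_fourierChar_div
  sum_range_mul_periodic)

/-! ### One period: the Fourier expansion of the dilate correlation -/

/-- **Orthogonality step.** For a `P`-periodic real `g` with finite Fourier coefficients
`c(h) = P⁻¹ Σ_{u<P} g(u) e(−hu/P)`:
`Σ_{m<P} g(pm) g(qm) = Σ_{h,h'<P} c(h) c(h') · P·[P ∣ ph + qh']`. [folklore] -/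
theorem sum_mul_dilates_eq {P : ℕ} (hP : 0 < P) (g : ℕ → ℝ) (hg : ∀ u, g (u + P) = g u)
    (c : ℕ → ℂ)
    (hc : ∀ h, c h = (P : ℂ)⁻¹ * ∑ u ∈ range P, (g u : ℂ) * (𝐞 ((u : ℝ) * (-(h : ℝ) / P)) : ℂ))
    (p q : ℕ) :
    ∑ m ∈ range P, ((g (p * m) : ℝ) : ℂ) * ((g (q * m) : ℝ) : ℂ) =
      ∑ h ∈ range P, ∑ h' ∈ range P,
        c h * c h' * (if P ∣ p * h + q * h' then (P : ℂ) else 0) := by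
  have hinv : ∀ x : ℕ, ((g x : ℝ) : ℂ) =
      ∑ h ∈ range P, c h * (𝐞 ((x : ℝ) * ((h : ℝ) / P)) : ℂ) := by
    intro x
    rw [fourier_inversion hP (fun u => ((g u : ℝ) : ℂ)) (fun w => by simp only [hg]) x]
    exact Finset.sum_congr rfl fun h _ => by rw [hc]
  have horth : ∀ n : ℕ, ∑ m ∈ range P, (𝐞 ((m : ℝ) * ((n : ℝ) / P)) : ℂ) =
      if P ∣ n then (P : ℂ) else 0 := by
    intro n
    have := sum_range_fourierChar_div P hP (n : ℤ)
    simp only [Int.cast_natCast] at this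
    rw [this]
    by_cases hd : P ∣ n
    · rw [if_pos hd, if_pos (Int.natCast_dvd_natCast.2 hd)]
    · rw [if_neg hd, if_neg (fun h => hd (Int.natCast_dvd_natCast.1 h))]
  have hterm : ∀ m : ℕ, ((g (p * m) : ℝ) : ℂ) * ((g (q * m) : ℝ) : ℂ) =
      ∑ h ∈ range P, ∑ h' ∈ range P,
        c h * c h' * (𝐞 ((m : ℝ) * (((p * h + q * h' : ℕ) : ℝ) / P)) : ℂ) := by
    intro m
    rw [hinv (p * m), hinv (q * m), Finset.sum_mul_sum]
    refine Finset.sum_congr rfl fun h _ => Finset.sum_congr rfl fun h' _ => ?_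
    have e : (𝐞 (((p * m : ℕ) : ℝ) * ((h : ℝ) / P)) : ℂ) *
        (𝐞 (((q * m : ℕ) : ℝ) * ((h' : ℝ) / P)) : ℂ) =
        (𝐞 ((m : ℝ) * (((p * h + q * h' : ℕ) : ℝ) / P)) : ℂ) := by
      rw [← Circle.coe_mul, ← AddChar.map_add_eq_mul]
      congr 2
      push_cast
      ring
    rw [← e]
    ring
  rw [Finset.sum_congr rfl fun m _ => hterm m, Finset.sum_comm]
  refine Finset.sum_congr rfl fun h _ => ?_
  rw [Finset.sum_comm]
  refine Finset.sum_congr rfl fun h' _ => ?_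
  rw [← Finset.mul_sum, horth]

/-- The resulting bound `‖Σ_{m<P} g(pm)g(qm)‖ ≤ P · Σ_{P ∣ ph+qh'} ‖c(h)‖‖c(h')‖`. [folklore] -/
theorem norm_sum_mul_dilates_le {P : ℕ} (hP : 0 < P) (g : ℕ → ℝ) (hg : ∀ u, g (u + P) = g u)
    (c : ℕ → ℂ)
    (hc : ∀ h, c h = (P : ℂ)⁻¹ * ∑ u ∈ range P, (g u : ℂ) * (𝐞 ((u : ℝ) * (-(h : ℝ) / P)) : ℂ))
    (p q : ℕ) :
    ‖∑ m ∈ range P, ((g (p * m) : ℝ) : ℂ) * ((g (q * m) : ℝ) : ℂ)‖ ≤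
      (P : ℝ) * ∑ h ∈ range P, ∑ h' ∈ range P,
        (if P ∣ p * h + q * h' then ‖c h‖ * ‖c h'‖ else 0) := by
  rw [sum_mul_dilates_eq hP g hg c hc p q, Finset.mul_sum]
  refine (norm_sum_le _ _).trans (Finset.sum_le_sum fun h _ => ?_)
  rw [Finset.mul_sum]
  refine (norm_sum_le _ _).trans (Finset.sum_le_sum fun h' _ => ?_)
  split_ifs with hd
  · rw [norm_mul, norm_mul, Complex.norm_natCast]; linarith
  · simp

/-- The square wave of period `P = 2^{j+1}` has mean zero: `Σ_{u<P} g(u) = 0`. [folklore] -/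
theorem sum_squareWave_eq_zero {P j : ℕ} (hP : P = 2 ^ (j + 1)) (g : ℕ → ℝ)
    (hg : ∀ u, g u = if P / 2 ≤ u % P then -1 else 1) :
    ∑ u ∈ range P, g u = 0 := by
  have h2 : P / 2 = 2 ^ j := by rw [hP, pow_succ, Nat.mul_div_cancel _ two_pos]
  have hPP : P = 2 ^ j + 2 ^ j := by rw [hP, pow_succ]; ring
  have hA : ∑ u ∈ range (2 ^ j), g u = ∑ u ∈ range (2 ^ j), (1 : ℝ) := by
    refine Finset.sum_congr rfl fun u hu => ?_
    rw [Finset.mem_range] at hu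
    rw [hg, h2, Nat.mod_eq_of_lt (by rw [hPP]; omega), if_neg (by omega)]
  have hB : ∑ u ∈ range (2 ^ j), g (2 ^ j + u) = ∑ u ∈ range (2 ^ j), (-1 : ℝ) := by
    refine Finset.sum_congr rfl fun u hu => ?_
    rw [Finset.mem_range] at hu
    rw [hg, h2, Nat.mod_eq_of_lt (by rw [hPP]; omega), if_pos (by omega)]
  rw [hPP, Finset.sum_range_add, hA, hB]
  simp

/-! ### Periodic sums -/

/-- `|Σ_{k<N} F(k)| ≤ (N/P)|Σ_{k<P} F(k)| + P` for a `P`-periodic `F` with `|F| ≤ 1`. [folklore] -/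
theorem abs_sum_range_le_of_periodic {F : ℕ → ℝ} {P : ℕ} (hP : 0 < P)
    (hF : ∀ k, F (k + P) = F k) (hF1 : ∀ k, |F k| ≤ 1) (N : ℕ) :
    |∑ k ∈ range N, F k| ≤ (N : ℝ) / P * |∑ k ∈ range P, F k| + P := by
  have hsplit : ∑ k ∈ range N, F k =
      ((N / P : ℕ) : ℝ) * ∑ k ∈ range P, F k + ∑ k ∈ range (N % P), F (P * (N / P) + k) := by
    conv_lhs => rw [← Nat.div_add_mod N P]
    rw [Finset.sum_range_add, sum_range_mul_periodic F hF (N / P), nsmul_eq_mul]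
  rw [hsplit]
  calc _ ≤ |((N / P : ℕ) : ℝ) * ∑ k ∈ range P, F k| +
        |∑ k ∈ range (N % P), F (P * (N / P) + k)| := abs_add_le _ _
    _ ≤ (N : ℝ) / P * |∑ k ∈ range P, F k| + P := by
        refine add_le_add ?_ ?_
        · rw [abs_mul, Nat.abs_cast]
          exact mul_le_mul_of_nonneg_right Nat.cast_div_le (abs_nonneg _)
        · calc _ ≤ ∑ k ∈ range (N % P), |F (P * (N / P) + k)| := Finset.abs_sum_le_sum_abs _ _
            _ ≤ ∑ _k ∈ range (N % P), (1 : ℝ) := Finset.sum_le_sum fun k _ => hF1 _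
            _ = ((N % P : ℕ) : ℝ) := by simp
            _ ≤ P := by exact_mod_cast (Nat.mod_lt N hP).le

end StubSingleDigit

open StubSingleDigit in
open Literature.NumberTheory.LFunctions.GreenWalsh (norm_squareWave_coeff_le squareWave_periodic
  sgn_testBit_eq sum_range_shift) in
/-- **Stub (prime dilates of a single binary digit decorrelate).** There is an absolute `C` such
that for all odd primes `p < q`, every digit position `j` and every length `M`,
`|Σ_{1 ≤ m ≤ M} (−1)^{bit_j(pm)} (−1)^{bit_j(qm)}| ≤ C M/(pq) + C M q²(j+1)/2^j + C 2^j`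
(here `C = 32`): complete the sum to periods `2^{j+1}`, expand the digit square wave on `ℤ/2^{j+1}`
in its finite Fourier series (`|ĝ(h)| ≤ 2/min(h, 2^{j+1} − h)`, `ĝ(0) = 0`), and bound the partner
sum `Σ_{P ∣ ph+qh'} |ĝ(h)||ĝ(h')|` by the dichotomy `pa = qb` or `pa + qb ≥ P` for the distances
`a, b` of `h, h'` to `0`. [folklore] -/
theorem stub_singleDigit :
    ∃ C : ℝ, ∀ p q j M : ℕ, p.Prime → q.Prime → 2 < p → p < q →
      |∑ m ∈ Icc 1 M, (if Nat.testBit (p * m) j then (-1 : ℝ) else 1) *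
          (if Nat.testBit (q * m) j then (-1 : ℝ) else 1)| ≤
        C * M / (p * q) + C * M * (q : ℝ) ^ 2 * (j + 1) / 2 ^ j + C * 2 ^ j := by
  refine ⟨32, fun p q j M hp hq h2p hpq => ?_⟩
  -- the period and the square wave
  obtain ⟨P, hPdef⟩ : ∃ P : ℕ, P = 2 ^ (j + 1) := ⟨_, rfl⟩
  have hP : 0 < P := by rw [hPdef]; positivity
  have hPeven : 2 ∣ P := ⟨2 ^ j, by rw [hPdef, pow_succ, mul_comm]⟩
  have hPreal : (P : ℝ) = 2 * 2 ^ j := by rw [hPdef]; push_cast; ring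
  obtain ⟨g, hg⟩ : ∃ g : ℕ → ℝ, ∀ u, g u = if P / 2 ≤ u % P then -1 else 1 := ⟨_, fun _ => rfl⟩
  have hgper : ∀ u, g (u + P) = g u := squareWave_periodic g hg
  have hg1 : ∀ u, |g u| ≤ 1 := fun u => by rw [hg]; split_ifs <;> simp
  have hgP : ∀ x k, g (x + k * P) = g x := fun x k => by
    rw [hg, hg x, Nat.add_mul_mod_self_right]
  have hsgn : ∀ x, (if Nat.testBit x j then (-1 : ℝ) else 1) = g x := fun x => by
    have := sgn_testBit_eq x j
    unfold Literature.Probability.RandomGraphs.LowDegree.sgn at this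
    rw [← hPdef] at this
    rw [hg]
    exact this
  -- odd primes: coprimality
  have hpodd : Odd p := hp.odd_of_ne_two (by omega)
  have hqodd : Odd q := hq.odd_of_ne_two (by omega)
  have hcop : Nat.Coprime p q := (Nat.coprime_primes hp hq).2 (by omega)
  have hPp : Nat.Coprime P p := by rw [hPdef]; exact (Nat.coprime_two_left.2 hpodd).pow_left _
  have hPq : Nat.Coprime P q := by rw [hPdef]; exact (Nat.coprime_two_left.2 hqodd).pow_left _
  have hp0 : (0 : ℝ) < p := by exact_mod_cast hp.pos
  have hq1 : (1 : ℝ) ≤ q := by exact_mod_cast hq.one_lt.le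
  -- the Fourier coefficients of the square wave
  obtain ⟨c, hc⟩ : ∃ c : ℕ → ℂ, ∀ h, c h =
      (P : ℂ)⁻¹ * ∑ u ∈ range P, (g u : ℂ) * (𝐞 ((u : ℝ) * (-(h : ℝ) / P)) : ℂ) :=
    ⟨_, fun _ => rfl⟩
  have hc0 : c 0 = 0 := by
    rw [hc]
    have h1 : ∀ u : ℕ, (𝐞 ((u : ℝ) * (-((0 : ℕ) : ℝ) / P)) : ℂ) = 1 := fun u => by
      rw [Nat.cast_zero, neg_zero, zero_div, mul_zero, AddChar.map_zero_eq_one, Circle.coe_one]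
    simp_rw [h1, mul_one]
    rw [← Complex.ofReal_sum, sum_squareWave_eq_zero hPdef g hg, Complex.ofReal_zero, mul_zero]
  have hcb : ∀ h, 0 < h → h < P → ‖c h‖ ≤ 2 / ((min h (P - h) : ℕ) : ℝ) := fun h h0 hh => by
    rw [hc]; exact norm_squareWave_coeff_le hPeven h0 hh g hg
  -- one period
  have hB : 16 / ((p : ℝ) * q) + 16 * ((p : ℝ) + q) / P * (1 + Real.log P) ≤
      16 / ((p : ℝ) * q) + 32 * (q : ℝ) * (j + 1) / 2 ^ j := by
    have hlog : 1 + Real.log P ≤ 2 * ((j : ℝ) + 1) := by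
      have hPr : (P : ℝ) = 2 ^ (j + 1) := by rw [hPdef]; push_cast; ring
      rw [hPr, Real.log_pow]
      have hlog2 : Real.log 2 ≤ 1 := by
        have := Real.log_le_sub_one_of_pos (show (0 : ℝ) < 2 by norm_num); linarith
      have : ((j + 1 : ℕ) : ℝ) * Real.log 2 ≤ ((j + 1 : ℕ) : ℝ) * 1 :=
        mul_le_mul_of_nonneg_left hlog2 (by positivity)
      push_cast at this ⊢
      linarith
    have hlog0 : 0 ≤ 1 + Real.log P := by
      have : 0 ≤ Real.log P := Real.log_nonneg (by exact_mod_cast hP)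
      linarith
    have hpq2 : 16 * ((p : ℝ) + q) / P ≤ 16 * ((q : ℝ) / 2 ^ j) := by
      rw [mul_div_assoc]
      refine mul_le_mul_of_nonneg_left ?_ (by norm_num)
      rw [hPreal, div_le_div_iff₀ (by positivity) (by positivity)]
      have : (p : ℝ) ≤ q := by exact_mod_cast hpq.le
      nlinarith [show (0 : ℝ) < 2 ^ j by positivity]
    have := mul_le_mul hpq2 hlog hlog0 (by positivity)
    calc _ ≤ 16 / ((p : ℝ) * q) + 16 * ((q : ℝ) / 2 ^ j) * (2 * ((j : ℝ) + 1)) := by linarith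
      _ = _ := by ring
  have hperiod : |∑ m ∈ range P, g (p * m) * g (q * m)| ≤
      P * (16 / ((p : ℝ) * q) + 32 * (q : ℝ) * (j + 1) / 2 ^ j) := by
    have h1 := norm_sum_mul_dilates_le hP g hgper c hc p q
    have h2 := double_sum_le hP hp.pos hq.pos hcop hPp hPq c hc0 hcb
    have h4 : ‖∑ m ∈ range P, ((g (p * m) : ℝ) : ℂ) * ((g (q * m) : ℝ) : ℂ)‖ =
        |∑ m ∈ range P, g (p * m) * g (q * m)| := by
      rw [← Real.norm_eq_abs, ← Complex.norm_real]
      push_cast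
      rfl
    rw [← h4]
    exact h1.trans (mul_le_mul_of_nonneg_left (h2.trans hB) (by positivity))
  -- periodization
  obtain ⟨F, hF⟩ : ∃ F : ℕ → ℝ, ∀ m, F m = g (p * m) * g (q * m) := ⟨_, fun _ => rfl⟩
  have hFper : ∀ m, F (m + P) = F m := fun m => by
    rw [hF, hF m, mul_add, mul_add, hgP, hgP]
  have hF1 : ∀ m, |F m| ≤ 1 := fun m => by
    rw [hF, abs_mul]
    exact mul_le_one₀ (hg1 _) (abs_nonneg _) (hg1 _)
  have hIcc : ∑ m ∈ Icc 1 M, (if Nat.testBit (p * m) j then (-1 : ℝ) else 1) *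
      (if Nat.testBit (q * m) j then (-1 : ℝ) else 1) = ∑ k ∈ range M, F (1 + k) := by
    rw [← Finset.Ico_add_one_right_eq_Icc, Finset.sum_Ico_eq_sum_range, Nat.add_sub_cancel]
    refine Finset.sum_congr rfl fun k _ => ?_
    rw [hsgn, hsgn, hF]
  have hmain := abs_sum_range_le_of_periodic hP (F := fun k => F (1 + k))
    (fun k => by show F (1 + (k + P)) = F (1 + k); rw [← add_assoc, hFper]) (fun k => hF1 _) M
  have hshift : ∑ k ∈ range P, F (1 + k) = ∑ k ∈ range P, F k := sum_range_shift F hFper 1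
  have hperiod' : |∑ k ∈ range P, F k| ≤
      P * (16 / ((p : ℝ) * q) + 32 * (q : ℝ) * (j + 1) / 2 ^ j) := by
    have : ∑ k ∈ range P, F k = ∑ m ∈ range P, g (p * m) * g (q * m) :=
      Finset.sum_congr rfl fun k _ => hF k
    rw [this]; exact hperiod
  rw [hIcc]
  simp only [hshift] at hmain
  have hP0 : (0 : ℝ) < P := by exact_mod_cast hP
  have hBnn : 0 ≤ 16 / ((p : ℝ) * q) + 32 * (q : ℝ) * (j + 1) / 2 ^ j := by positivity
  have hY : (M : ℝ) * q * (j + 1) / 2 ^ j ≤ M * (q : ℝ) ^ 2 * (j + 1) / 2 ^ j := by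
    have hqq : (q : ℝ) ≤ (q : ℝ) ^ 2 := by nlinarith
    have hY0 : 0 ≤ (M : ℝ) * (j + 1) / 2 ^ j := by positivity
    calc (M : ℝ) * q * (j + 1) / 2 ^ j = q * (M * (j + 1) / 2 ^ j) := by ring
      _ ≤ (q : ℝ) ^ 2 * (M * (j + 1) / 2 ^ j) := mul_le_mul_of_nonneg_right hqq hY0
      _ = _ := by ring
  have hX : 0 ≤ (M : ℝ) / (p * q) := by positivity
  have h2j : (0 : ℝ) < 2 ^ j := by positivity
  calc |∑ k ∈ range M, F (1 + k)| ≤ (M : ℝ) / P * |∑ k ∈ range P, F k| + P := hmain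
    _ ≤ (M : ℝ) / P * (P * (16 / ((p : ℝ) * q) + 32 * (q : ℝ) * (j + 1) / 2 ^ j)) + P := by
        gcongr
    _ = 16 * ((M : ℝ) / (p * q)) + 32 * ((M : ℝ) * q * (j + 1) / 2 ^ j) + 2 * 2 ^ j := by
        rw [hPreal]; field_simp
    _ ≤ 32 * M / (p * q) + 32 * M * (q : ℝ) ^ 2 * (j + 1) / 2 ^ j + 32 * 2 ^ j := by
        have e1 : (32 : ℝ) * M / (p * q) = 32 * ((M : ℝ) / (p * q)) := by ring
        have e2 : (32 : ℝ) * M * (q : ℝ) ^ 2 * (j + 1) / 2 ^ j =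
            32 * ((M : ℝ) * (q : ℝ) ^ 2 * (j + 1) / 2 ^ j) := by ring
        rw [e1, e2]
        linarith


end Summit.QuantumAdvantage.DigitPolyUniformity.Sketch

end
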